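import Summits.QuantumFields.BalabanUV.Beta.D1BFx.ShellWindowInterface
import Literature.MathematicalPhysics.QuantumFieldTheory.Balaban1983to89.Beta.WindowIdentification

/-!
# `BalabanUV.Beta.D1BFx.ShellFullSum` — road «BF-x» for binder row D1, sub-leaf C3-SHELL (companion):
# THE FULL LATTICE SUM AND THE IDENTIFICATION BINDER FROM SHELL-ℓ¹ TAILS

HONEST DEPENDENCY (page 1, mandatory): continuum YM on T⁴ ⇐ BetaPertH ∧ nine spine estimates (0/9 proved); BetaPertH ⇐ (D1) ∧
(D4) ∧ CAP+tail; G-an2-4 gates asym, D1 and NE2/3/4.  HONEST FRAMING (cell contract, verbatim): «discharging `BetaPertH` makes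
Bałaban's UV stability UNCONDITIONAL — a real constructive-QFT result; it is NOT the continuum limit and NOT the Clay problem.»
THIS MODULE DISCHARGES NOTHING of the wall: [folklore] bookkeeping about ARBITRARY functions `ℤ⁴ → ℝ`, the shell twin of
`WindowIdentification` §2–§3 (`abs_psum_sub_psum_le`, `cauchySeq_psum_of_shellBound`, `tendsto_fullSum_of_shellBound`,
`abs_fullSum_sub_psum_le`) and of `SquareTable.hident_of_fullSum_graded_avg`, composed BY NAME from part 1's
`ShellWindowInterface.tail_sum_le_exp_shell`, `WindowIdentification.psum_sub_psum` / `tendsto_fullSum`, `ComposedRoad.abs_convexComb_le`.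
No `def`, no `Prop` mirror, no cited fact, 0 sorry.  0 wall binders instantiated; NOT D1, NOT `BetaPertH`, NOT continuum, NOT Clay.

ABSOLUTE RULE (cell charter, verbatim): «No internally-minted statement may enter as a cited fact. Every hypothesis is either
kernel-proved in this package or a verbatim quotation of a PUBLISHED theorem with page reference. The manuscript(s) under audit are NOT
citable for their own disputed steps — they are the thing under adjudication; programme-internal (2001/route/tribunal) claims are never
citable.»  Accordingly nothing below is a statement about Bałaban's kernels; every hypothesis is a free binder on abstract families.

WHY.  The road's identification (W3b′) is stated against the FULL lattice sum `fullSum K := lim_R Σ_{0<‖w‖∞≤R} K(w)`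
(`RoadEnd.d1Drift_of_strongRoad`, binder `hT`; an3's `SquareTable.oneLoopDrift_of_scalarBounds_avg`, binder `hU`), and the passage to the
finite-window form needs the partial sums to converge with a rate.  The tree derives this from the POINTWISE shell tail
`|K w| ≤ E(r+1)⁻⁴e^{−(δ/n)(r+1)}`; the shell-ℓ¹ tail `Σ_{‖w‖∞=r+1}|K w| ≤ 80E(r+1)⁻¹e^{−(δ/n)(r+1)}` (the currency of
`D1BFx/ShellWindowInterface`) gives the SAME rate `80E(1 + n/δ)/(R+1)`.
* §1 `abs_psum_sub_psum_le_shell`, `cauchySeq_psum_of_shellRows`, `tendsto_fullSum_of_shellRows`, `abs_fullSum_sub_psum_le_shell`.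
* §2 `hident_of_fullSum_avg_shell`: per-base-point shell tails with a `b`-free constant + `|composedCoeff μC m − Σ_b wt_b·fullSum K_{m,b}| ≤ U`
  ⟹ `∃ R₀ ≥ M(Lc^m), |composedCoeff μC m − Σ_b wt_b·Σ_{0<‖w‖∞≤R₀} K_{m,b}| ≤ U + ε` (any `ε > 0`).
Unit `b2b-balaban-beta-d1-formalise-leaf-07` (gen 4), D1 formalisation swarm; `LEAVES-BFx.md` sub-row C3-SHELL; journal CLAIM l.11259.
-/

namespace Summit.QuantumFields.BalabanUV.Beta.D1BFx.ShellFullSum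

open Finset Filter Topology
open scoped BigOperators
open Literature.Probability.LatticeModels (annulus)
open Literature.MathematicalPhysics.QuantumFieldTheory.Balaban1983to89
open Literature.MathematicalPhysics.QuantumFieldTheory.Balaban1983to89.Beta
open Literature.MathematicalPhysics.QuantumFieldTheory.Balaban1983to89.Beta.DyadicShell (Pt toReal supNorm)
open Literature.MathematicalPhysics.QuantumFieldTheory.Balaban1983to89.Beta.WindowIdentification (psum fullSum psum_sub_psum
  tendsto_fullSum)
open Literature.MathematicalPhysics.QuantumFieldTheory.Balaban1983to89.Beta.MarginalTelescoping (composedCoeff)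
open Summit.QuantumFields.BalabanUV.Beta.D1BFx.ShellWindowInterface (tail_sum_le_exp_shell)

noncomputable section

/-! ## §1 Convergence of the partial sums from shell-ℓ¹ tails -/

section Limit

variable {K : Pt → ℝ} {E δ Lr : ℝ} {M : ℕ}

/-- [folklore] The tail bound of `ShellWindowInterface.tail_sum_le_exp_shell` in `psum` form: for `M ≤ R ≤ R′`,
`|psum K R′ − psum K R| ≤ 80E(1 + L/δ)/(R+1)`. -/
theorem abs_psum_sub_psum_le_shell (hE : 0 ≤ E) (hδ : 0 < δ) (hL : 0 < Lr)
    (h : ∀ r : ℕ, M ≤ r → ∑ w ∈ annulus 4 r (r + 1), |K w| ≤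
      80 * E / ((r : ℝ) + 1) * Real.exp (-(δ / Lr) * ((r : ℝ) + 1)))
    {R R' : ℕ} (hMR : M ≤ R) (hRR' : R ≤ R') :
    |psum K R' - psum K R| ≤ 80 * E * (1 + Lr / δ) / ((R : ℝ) + 1) := by
  rw [psum_sub_psum K hRR']
  exact tail_sum_le_exp_shell hE hδ hL hRR' fun r hr => h r (le_trans hMR hr)

/-- [folklore] **The partial sums are Cauchy** under the shell-ℓ¹ scale-`L` exponential bound beyond `M`. -/
theorem cauchySeq_psum_of_shellRows (hE : 0 ≤ E) (hδ : 0 < δ) (hL : 0 < Lr)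
    (h : ∀ r : ℕ, M ≤ r → ∑ w ∈ annulus 4 r (r + 1), |K w| ≤
      80 * E / ((r : ℝ) + 1) * Real.exp (-(δ / Lr) * ((r : ℝ) + 1))) :
    CauchySeq (psum K) := by
  refine Metric.cauchySeq_iff'.mpr fun ε hε => ?_
  set T : ℝ := 80 * E * (1 + Lr / δ) with hT
  have hT0 : 0 ≤ T := by rw [hT]; positivity
  obtain ⟨N₀, hN₀⟩ := exists_nat_gt (T / ε)
  refine ⟨max M N₀, fun n hn => ?_⟩
  have hMn : M ≤ max M N₀ := le_max_left _ _
  have hNpos : (0 : ℝ) < ((max M N₀ : ℕ) : ℝ) + 1 := by positivity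
  have hN₀' : T / ε < ((max M N₀ : ℕ) : ℝ) + 1 := by
    have : (N₀ : ℝ) ≤ ((max M N₀ : ℕ) : ℝ) := by exact_mod_cast le_max_right M N₀
    linarith
  rw [Real.dist_eq]
  calc |psum K n - psum K (max M N₀)| ≤ T / (((max M N₀ : ℕ) : ℝ) + 1) := abs_psum_sub_psum_le_shell hE hδ hL h hMn hn
    _ < ε := by
        rw [div_lt_iff₀ hNpos]
        calc T = T / ε * ε := by field_simp
          _ < (((max M N₀ : ℕ) : ℝ) + 1) * ε := mul_lt_mul_of_pos_right hN₀' hε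
          _ = ε * (((max M N₀ : ℕ) : ℝ) + 1) := mul_comm _ _

/-- [folklore] Hence the partial sums converge to `fullSum K`. -/
theorem tendsto_fullSum_of_shellRows (hE : 0 ≤ E) (hδ : 0 < δ) (hL : 0 < Lr)
    (h : ∀ r : ℕ, M ≤ r → ∑ w ∈ annulus 4 r (r + 1), |K w| ≤
      80 * E / ((r : ℝ) + 1) * Real.exp (-(δ / Lr) * ((r : ℝ) + 1))) :
    Tendsto (psum K) atTop (𝓝 (fullSum K)) :=
  tendsto_fullSum (cauchySeq_tendsto_of_complete (cauchySeq_psum_of_shellRows hE hδ hL h))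

/-- [folklore] **Quantitative rate**: `|fullSum K − psum K R| ≤ 80E(1 + L/δ)/(R+1)` for every `R ≥ M`. -/
theorem abs_fullSum_sub_psum_le_shell (hE : 0 ≤ E) (hδ : 0 < δ) (hL : 0 < Lr)
    (h : ∀ r : ℕ, M ≤ r → ∑ w ∈ annulus 4 r (r + 1), |K w| ≤
      80 * E / ((r : ℝ) + 1) * Real.exp (-(δ / Lr) * ((r : ℝ) + 1)))
    {R : ℕ} (hMR : M ≤ R) :
    |fullSum K - psum K R| ≤ 80 * E * (1 + Lr / δ) / ((R : ℝ) + 1) := by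
  have hlim : Tendsto (fun n => |psum K n - psum K R|) atTop (𝓝 |fullSum K - psum K R|) :=
    ((tendsto_fullSum_of_shellRows hE hδ hL h).sub_const _).abs
  refine le_of_tendsto hlim ?_
  filter_upwards [eventually_ge_atTop R] with n hn
  exact abs_psum_sub_psum_le_shell hE hδ hL h hMR hn

end Limit

/-! ## §2 The identification binder from a base-point-averaged full-sum comparison -/

section Ident

variable {κB : Type*}

/-- [folklore] **WINDOW TRUNCATION OF A BASE-POINT-AVERAGED FULL-SUM IDENTIFICATION, shell-ℓ¹ tails** (twin of
`SquareTable.hident_of_fullSum_graded_avg`): a `b`-FREE shell-ℓ¹ exponential tail of every `K_{m,b}` beyond `M(Lc^m)` makes the window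
truncation uniform in `b`, so `|composedCoeff μC m − Σ_b wt_b·fullSum K_{m,b}| ≤ U` gives a window radius `R₀ ≥ M(Lc^m)` with
`|composedCoeff μC m − Σ_b wt_b·Σ_{0<‖w‖∞≤R₀} K_{m,b}(w)| ≤ U + ε`. -/
theorem hident_of_fullSum_avg_shell {μC : ℕ → ℕ → ℝ} {K : ℕ → κB → Pt → ℝ} {Lc : ℕ} (hLc : 1 ≤ Lc) {M : ℕ → ℕ} {E δ U : ℝ}
    (hE : 0 ≤ E) (hδ : 0 < δ) {Bset : ℕ → Finset κB} {wt : ℕ → κB → ℝ}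
    (hwt0 : ∀ m : ℕ, 1 ≤ m → ∀ b ∈ Bset (Lc ^ m), 0 ≤ wt (Lc ^ m) b) (hwt1 : ∀ m : ℕ, 1 ≤ m → ∑ b ∈ Bset (Lc ^ m), wt (Lc ^ m) b = 1)
    (htail : ∀ m : ℕ, 1 ≤ m → ∀ b ∈ Bset (Lc ^ m), ∀ r : ℕ, M (Lc ^ m) ≤ r →
      ∑ w ∈ annulus 4 r (r + 1), |K m b w| ≤ 80 * E / ((r : ℝ) + 1) * Real.exp (-(δ / ((Lc ^ m : ℕ) : ℝ)) * ((r : ℝ) + 1)))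
    (hU : ∀ m : ℕ, 1 ≤ m → |composedCoeff μC m - ∑ b ∈ Bset (Lc ^ m), wt (Lc ^ m) b * fullSum (K m b)| ≤ U) {ε : ℝ} (hε : 0 < ε) :
    ∀ m : ℕ, 1 ≤ m → ∃ R₀ : ℕ, M (Lc ^ m) ≤ R₀ ∧
      |composedCoeff μC m - ∑ b ∈ Bset (Lc ^ m), wt (Lc ^ m) b * ∑ w ∈ annulus 4 0 R₀, K m b w| ≤ U + ε := by
  intro m hm
  have hn : (0 : ℝ) < ((Lc ^ m : ℕ) : ℝ) := by
    have : 0 < Lc ^ m := pow_pos (by omega) m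
    exact_mod_cast this
  set T : ℝ := 80 * E * (1 + ((Lc ^ m : ℕ) : ℝ) / δ) with hT
  have hT0 : 0 ≤ T := by rw [hT]; positivity
  obtain ⟨N₀, hN₀⟩ := exists_nat_gt (T / ε)
  set R₀ : ℕ := max (M (Lc ^ m)) N₀ with hR₀
  refine ⟨R₀, le_max_left _ _, ?_⟩
  have hNpos : (0 : ℝ) < (R₀ : ℝ) + 1 := by positivity
  have hN₀' : T / ε < (R₀ : ℝ) + 1 :=
    hN₀.trans_le (by exact_mod_cast (le_max_right (M (Lc ^ m)) N₀).trans (Nat.le_succ _))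
  have hsmall : T / ((R₀ : ℝ) + 1) ≤ ε := by
    rw [div_le_iff₀ hNpos]
    have := (div_lt_iff₀ hε).1 hN₀'
    nlinarith
  have hb : ∀ b ∈ Bset (Lc ^ m), |fullSum (K m b) - psum (K m b) R₀| ≤ ε := fun b hb =>
    (abs_fullSum_sub_psum_le_shell hE hδ hn (htail m hm b hb) (le_max_left _ _)).trans hsmall
  have hconv : |∑ b ∈ Bset (Lc ^ m), wt (Lc ^ m) b * (fullSum (K m b) - psum (K m b) R₀)| ≤ ε :=
    ComposedRoad.abs_convexComb_le (hwt0 m hm) (hwt1 m hm) hb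
  have hsplit : composedCoeff μC m - ∑ b ∈ Bset (Lc ^ m), wt (Lc ^ m) b * ∑ w ∈ annulus 4 0 R₀, K m b w =
      (composedCoeff μC m - ∑ b ∈ Bset (Lc ^ m), wt (Lc ^ m) b * fullSum (K m b)) +
        ∑ b ∈ Bset (Lc ^ m), wt (Lc ^ m) b * (fullSum (K m b) - psum (K m b) R₀) := by
    simp only [psum, mul_sub, Finset.sum_sub_distrib]
    ring
  rw [hsplit]
  exact (abs_add_le _ _).trans (add_le_add (hU m hm) hconv)

end Ident

end

end Summit.QuantumFields.BalabanUV.Beta.D1BFx.ShellFullSum
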